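import Summits.AtomisticToContinuum.Crystallization.Theses.FluxTubeKepler
import Summits.AtomisticToContinuum.Crystallization.Theorems.SquareWellLayerCakeGapTwelveToBarlowUniformSpacingSelectionHull

/-!
# `FluxTubeKepler.FloorGivesLayered` (stmt-AtomisticToContinuum-15223)

From the energy FLOOR `N·e(P₀) ≤ E(x)` and the defect BUDGET
`c(R,η)·#{(R,η)-non-layered sites} ≤ E(x) − N·e(P₀)` on Lennard-Jones ground states to the
layered-window hypothesis of `PeriodicGivenLayered`, for every ground-state sequence.

Mechanism (line `LandDilationDiagonal`; the mathematics is that of the crux's standing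
`Cruxes/FloorGivesLayered/Disproof.lean` candidate by refuter-rattack-stmt-AtomisticToContinuum-15223-0,
ported here WITHOUT auxiliary definitions):

1. ENERGY ⇒ GOOD SITES. FLOOR forces `e(P₀) = e* := ⨅_Q e(Q)` (`floor_iff_eq_eStar`, from the in-tree
   `crysEnergyLimit`, `eStar_le`, `card_mul_eStar_le`); since `E(N)/N → e*`, eventually
   `E(N) < N (e* + c)` and the budget leaves a site that is not bad (`eventually_exists_not_bad`,
   stated for an arbitrary `bad` predicate).
2. DILATION TRANSFER. A two-way `η`-matching of a point cloud with a set `S` on the ball of radius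
   `R' ≥ R + 1` is a two-way `ε`-matching with the dilate `ρ • S` on the ball of radius `R` as soon as
   `|1 − ρ|(R+1), |ρ⁻¹ − 1|(R+1) ≤ η₁/2`, `η ≤ η₁/2`, `η₁ ≤ min ε 1` (`match_dilate`, general sets); the
   relaxed layered family is dilation covariant (`layered_pt_scale`: spacing `ρb`, heights `ρz`).
3. ONE SPACING FOR ALL SCALES. For an abstract goodness predicate `G a R η N i` with such a transfer
   property, good sites frequently in `N` at every scale with scale-dependent spacings in `[47/50, 1]`
   give ONE spacing for all scales (`spacing_selection`: diagonal over the scales `(k+2, 1/(k+1))` and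
   Bolzano–Weierstrass on `[47/50, 1]`).
4. `floorGivesLayered` assembles 1–3 and translates by `t := −x N i`.
-/

noncomputable section

namespace Summit.AtomisticToContinuum.Crystallization.Theorems.FluxTubeKeplerFloorGivesLayered

open Literature.MathematicalPhysics.StatisticalMechanics Filter Topology
open Summit.AtomisticToContinuum.Crystallization.Theses.FluxTubeKepler
open Summit.AtomisticToContinuum.Crystallization.Theorems.ChargedEnergyGapNegative
open Summit.AtomisticToContinuum.Crystallization.Theorems.SquareWellLayerCakeGapTwelveToBarlow
  (sel_inplane_eq)

/-! ## 1. ENERGY ⇒ GOOD SITES -/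

/-- FLOOR(P₀) — `N·e(P₀) ≤ E(x)` for every Lennard-Jones ground state `x` of every size `N` — holds
iff `P₀` ATTAINS the periodic infimum `e* = ⨅_Q e(Q)` of the energy per particle. -/
theorem floor_iff_eq_eStar (P₀ : PeriodicConfiguration 3) :
    (∀ (N : ℕ) (x : Fin N → EuclideanSpace ℝ (Fin 3)), Literature.MathematicalPhysics.StatisticalMechanics.IsGroundState Literature.MathematicalPhysics.StatisticalMechanics.lennardJones x → (N : ℝ) * P₀.energyPerParticle Literature.MathematicalPhysics.StatisticalMechanics.lennardJones ≤ Literature.MathematicalPhysics.StatisticalMechanics.interactionEnergy Literature.MathematicalPhysics.StatisticalMechanics.lennardJones x) ↔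
      P₀.energyPerParticle lennardJones = eStar := by
  constructor
  · intro hE
    have hlim := crysEnergyLimit
    have hle : P₀.energyPerParticle lennardJones ≤ eStar := by
      refine ge_of_tendsto hlim (Filter.eventually_atTop.2 ⟨1, fun N hN => ?_⟩)
      obtain ⟨x, hx⟩ := LennardJonesGroundStatesExist_holds N
      have h1 := hE N x hx
      have hNr : (0 : ℝ) < N := by exact_mod_cast hN
      rw [le_div_iff₀ hNr, mul_comm]
      rw [hx.2] at h1
      exact h1
    exact le_antisymm hle (eStar_le P₀)
  · intro heq N x hx
    rw [heq]
    exact card_mul_eStar_le hx.1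

/-- Counting step, for an ARBITRARY site predicate `bad`: under FLOOR(P₀), if `c·#{bad sites} ≤
E(x) − N·e(P₀)` on ground states for some `c > 0`, then eventually in `N` every Lennard-Jones ground
state of `N` particles has a site that is not bad (`e(P₀) = e*` and `E(N)/N → e*`, so eventually
`E(N) < N (e* + c)`, whence `c·#bad < c·N`). -/
theorem eventually_exists_not_bad (P₀ : PeriodicConfiguration 3)
    (hE : ∀ (N : ℕ) (x : Fin N → EuclideanSpace ℝ (Fin 3)), Literature.MathematicalPhysics.StatisticalMechanics.IsGroundState Literature.MathematicalPhysics.StatisticalMechanics.lennardJones x → (N : ℝ) * P₀.energyPerParticle Literature.MathematicalPhysics.StatisticalMechanics.lennardJones ≤ Literature.MathematicalPhysics.StatisticalMechanics.interactionEnergy Literature.MathematicalPhysics.StatisticalMechanics.lennardJones x)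
    {bad : (N : ℕ) → (Fin N → EuclideanSpace ℝ (Fin 3)) → Fin N → Prop} {c : ℝ} (hc : 0 < c)
    (hcN : ∀ (N : ℕ) (x : Fin N → EuclideanSpace ℝ (Fin 3)), IsGroundState lennardJones x →
      c * (Nat.card {i : Fin N // bad N x i} : ℝ) ≤
        interactionEnergy lennardJones x - (N : ℝ) * P₀.energyPerParticle lennardJones) :
    ∀ᶠ N in atTop, ∀ x : Fin N → EuclideanSpace ℝ (Fin 3), IsGroundState lennardJones x →
      ∃ i : Fin N, ¬ bad N x i := by
  have heq := (floor_iff_eq_eStar P₀).1 hE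
  have hlim := crysEnergyLimit
  have hlt : (⨅ Q : PeriodicConfiguration 3, Q.energyPerParticle lennardJones) < eStar + c := by
    change eStar < eStar + c
    linarith
  have hev : ∀ᶠ N : ℕ in atTop, groundStateEnergy lennardJones 3 N / N < eStar + c :=
    hlim.eventually (gt_mem_nhds hlt)
  filter_upwards [hev, Filter.eventually_gt_atTop 0] with N hN hNpos x hx
  have h1 := hcN N x hx
  rw [heq, hx.2] at h1
  have hNr : (0 : ℝ) < N := by exact_mod_cast hNpos
  have h2 : groundStateEnergy lennardJones 3 N < (eStar + c) * N := by
    rwa [div_lt_iff₀ hNr] at hN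
  have h3 : c * (Nat.card {i : Fin N // bad N x i} : ℝ) < c * N := by nlinarith
  have h4 : (Nat.card {i : Fin N // bad N x i} : ℝ) < N := lt_of_mul_lt_mul_left h3 hc.le
  have h5 : Nat.card {i : Fin N // bad N x i} < N := by exact_mod_cast h4
  by_contra hno
  have hno' : ∀ i : Fin N, bad N x i := fun i => not_not.1 fun hi => hno ⟨i, hi⟩
  have hcard : Nat.card {i : Fin N // bad N x i} = N := by
    rw [Nat.card_congr (Equiv.subtypeUnivEquiv hno')]
    simp
  omega

/-! ## 2. DILATION TRANSFER of two-way matchings; dilation covariance of the layered family -/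

/-- DILATION TRANSFER. Let `q` be a point cloud two-way `η`-matched with a set `S` on the ball of radius
`R'`: every point of `S` of norm `≤ R'` has a cloud point within `η`, and every cloud point of norm `≤ R'`
has a point of `S` within `η`. If `S'` is the `ρ`-dilate of `S`, `R + 1 ≤ R'`, `η ≤ η₁/2`,
`η₁ ≤ min ε 1` and `|1 − ρ|, |ρ⁻¹ − 1| ≤ θ` with `θ (R+1) = η₁/2`, then `q` is two-way `ε`-matched with
`S'` on the ball of radius `R` (points of norm `≤ R + 1` move by at most `η₁/2` under the dilation). -/
theorem match_dilate {ι : Type*} (q : ι → EuclideanSpace ℝ (Fin 3))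
    (S S' : Set (EuclideanSpace ℝ (Fin 3))) {R R' ε η η₁ θ ρ : ℝ}
    (hθ0 : 0 < θ) (hθR : θ * (R + 1) = η₁ / 2) (hη₁ε : η₁ ≤ ε) (hη₁1 : η₁ ≤ 1)
    (hρ0 : 0 < ρ) (h1ρ : |1 - ρ| ≤ θ) (h1ρ' : |ρ⁻¹ - 1| ≤ θ)
    (hRR' : R + 1 ≤ R') (hηη₁ : η ≤ η₁ / 2)
    (hS : ∀ p ∈ S, ρ • p ∈ S') (hS' : ∀ p' ∈ S', ∃ p ∈ S, p' = ρ • p)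
    (hM₁ : ∀ p ∈ S, ‖p‖ ≤ R' → ∃ j, dist (q j) p ≤ η)
    (hM₂ : ∀ j, ‖q j‖ ≤ R' → ∃ p ∈ S, dist (q j) p ≤ η) :
    (∀ p' ∈ S', ‖p'‖ ≤ R → ∃ j, dist (q j) p' ≤ ε) ∧
      (∀ j, ‖q j‖ ≤ R → ∃ p' ∈ S', dist (q j) p' ≤ ε) := by
  constructor
  · -- every point of the dilated set in `‖·‖ ≤ R` has a cloud point within `ε`
    intro p' hp' hp'R
    obtain ⟨p, hpS, rfl⟩ := hS' p' hp'
    have hdiff : dist p (ρ • p) ≤ η₁ / 2 := by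
      have e1 : p - ρ • p = (ρ⁻¹ - 1) • (ρ • p) := by
        rw [sub_smul, smul_smul, inv_mul_cancel₀ hρ0.ne', one_smul, one_smul]
      rw [dist_eq_norm, e1, norm_smul, Real.norm_eq_abs, ← hθR]
      exact mul_le_mul h1ρ' (by linarith) (norm_nonneg _) hθ0.le
    have hpR : ‖p‖ ≤ R' := by
      have e1 := norm_le_norm_add_norm_sub' p (ρ • p)
      rw [← dist_eq_norm] at e1
      linarith
    obtain ⟨j, hj⟩ := hM₁ p hpS hpR
    refine ⟨j, ?_⟩
    calc dist (q j) (ρ • p) ≤ dist (q j) p + dist p (ρ • p) := dist_triangle _ _ _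
      _ ≤ η + η₁ / 2 := add_le_add hj hdiff
      _ ≤ ε := by linarith
  · -- every cloud point in `‖·‖ ≤ R` has a point of the dilated set within `ε`
    intro j hj
    obtain ⟨p, hpS, hd⟩ := hM₂ j (hj.trans (by linarith))
    refine ⟨ρ • p, hS p hpS, ?_⟩
    have hpR : ‖p‖ ≤ R + 1 := by
      have e1 : dist p 0 ≤ dist (q j) p + dist (q j) 0 := by
        have e0 := dist_triangle p (q j) 0
        rwa [dist_comm p (q j)] at e0
      rw [dist_zero_right, dist_zero_right] at e1
      have e3 : ‖q j‖ ≤ R := hj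
      linarith
    have hdiff : dist p (ρ • p) ≤ η₁ / 2 := by
      have e1 : p - ρ • p = (1 - ρ) • p := by rw [sub_smul, one_smul]
      rw [dist_eq_norm, e1, norm_smul, Real.norm_eq_abs, ← hθR]
      exact mul_le_mul h1ρ hpR (norm_nonneg _) hθ0.le
    calc dist (q j) (ρ • p) ≤ dist (q j) p + dist p (ρ • p) := dist_triangle _ _ _
      _ ≤ η + η₁ / 2 := add_le_add hd hdiff
      _ ≤ ε := by linarith

/-- DILATION COVARIANCE of the relaxed layered family: the layered point of spacing `ρ b` and heights
`ρ z` is the `ρ`-dilate of the layered point of spacing `b` and heights `z` (same chart `A`, same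
stacking word `s`, same indices). -/
theorem layered_pt_scale (A : EuclideanSpace ℝ (Fin 3) →ₗᵢ[ℝ] EuclideanSpace ℝ (Fin 3)) (ρ b : ℝ)
    (s : ℤ → ℤ) (z : ℤ → ℝ) (m k l : ℤ) :
    A (((k : ℝ) • triangularVec₁ (ρ * b)) + ((l : ℝ) • triangularVec₂ (ρ * b)) +
        ((haggLabel s m : ℝ) • barlowOffset (ρ * b)) + ((ρ * z m) • layerNormal 1)) =
      ρ • A (((k : ℝ) • triangularVec₁ b) + ((l : ℝ) • triangularVec₂ b) +
        ((haggLabel s m : ℝ) • barlowOffset b) + (z m • layerNormal 1)) := by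
  rw [← LinearIsometry.map_smul]
  congr 1
  rw [sel_inplane_eq (ρ * b) k l, sel_inplane_eq b k l]
  module

/-! ## 3. ONE SPACING FOR ALL SCALES (abstract diagonal extraction) -/

/-- SPACING SELECTION, for an abstract goodness predicate `G a R η N i` ("site `i` at size `N` is good at
spacing `a` and scale `(R, η)`") with the TRANSFER property `hT`: for every target scale `(R, ε)` there are
`δ > 0`, `R₀` and `η₀ > 0` such that goodness at a spacing `b` and any scale `(R', η')` with `R' ≥ R₀`,
`η' ≤ η₀` transfers to goodness at every spacing `a` with `|b − a| < δ` at scale `(R, ε)` (spacings in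
`[47/50, ∞)`). If good sites exist frequently in `N` at every scale, with scale- and `N`-dependent
spacings in `[47/50, 1]`, then ONE spacing `a ∈ [47/50, 1]` has good sites frequently in `N` at every
scale. Proof: diagonal over the scales `(k+2, 1/(k+1))` with sizes `N_k ≥ k`, Bolzano–Weierstrass on
`[47/50, 1]`, transfer from a late index of the convergent subsequence. -/
theorem spacing_selection {G : ℝ → ℝ → ℝ → (N : ℕ) → Fin N → Prop}
    (h : ∀ R η : ℝ, 0 < R → 0 < η →
      ∃ᶠ N in atTop, ∃ i : Fin N, ∃ a : ℝ, 47 / 50 ≤ a ∧ a ≤ 1 ∧ G a R η N i)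
    (hT : ∀ R ε : ℝ, 0 < R → 0 < ε → ∃ δ : ℝ, 0 < δ ∧ ∃ R₀ η₀ : ℝ, 0 < η₀ ∧
      ∀ a b R' η' : ℝ, 47 / 50 ≤ a → 47 / 50 ≤ b → |b - a| < δ → R₀ ≤ R' → η' ≤ η₀ →
        ∀ (N : ℕ) (i : Fin N), G b R' η' N i → G a R ε N i) :
    ∃ a : ℝ, 47 / 50 ≤ a ∧ a ≤ 1 ∧ ∀ R ε : ℝ, 0 < R → 0 < ε →
      ∃ᶠ N in atTop, ∃ i : Fin N, G a R ε N i := by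
  -- Step 1: a diagonal family of good sites at the scales `(k + 2, 1/(k + 1))`, sizes `N_k ≥ k`
  have hk : ∀ k : ℕ, ∃ N : ℕ, k ≤ N ∧ ∃ i : Fin N, ∃ a : ℝ, 47 / 50 ≤ a ∧ a ≤ 1 ∧
      G a ((k : ℝ) + 2) (1 / ((k : ℝ) + 1)) N i := fun k =>
    Filter.frequently_atTop.1
      (h ((k : ℝ) + 2) (1 / ((k : ℝ) + 1)) (by positivity) (by positivity)) k
  choose Nk hNk ik ak hak1 hak2 hgood using hk
  -- Step 2: Bolzano–Weierstrass on `[47/50, 1]`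
  obtain ⟨aS, haS, φ, hφ, hlim⟩ :=
    (isCompact_Icc : IsCompact (Set.Icc (47 / 50 : ℝ) 1)).tendsto_subseq (fun k => ⟨hak1 k, hak2 k⟩)
  refine ⟨aS, haS.1, haS.2, fun R ε hR hε => ?_⟩
  -- Step 3: for a target `(R, ε)` and a threshold `M`, a late enough index of the subsequence works
  rw [Filter.frequently_atTop]
  intro M
  obtain ⟨δ, hδ, R₀, η₀, hη₀, hTr⟩ := hT R ε hR hε
  obtain ⟨K₁, hK₁⟩ := Metric.tendsto_atTop.1 hlim δ hδ
  obtain ⟨K₂, hK₂⟩ := exists_nat_ge R₀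
  obtain ⟨K₃, hK₃⟩ := exists_nat_ge (1 / η₀)
  obtain ⟨k, hkM, hkK₁, hkK₂, hkK₃⟩ : ∃ k : ℕ, M ≤ k ∧ K₁ ≤ k ∧ K₂ ≤ k ∧ K₃ ≤ k :=
    ⟨max (max M K₁) (max K₂ K₃),
      le_trans (le_max_left _ _) (le_max_left _ _), le_trans (le_max_right _ _) (le_max_left _ _),
      le_trans (le_max_left _ _) (le_max_right _ _), le_trans (le_max_right _ _) (le_max_right _ _)⟩
  have hφk : k ≤ φ k := hφ.id_le k
  have hab : |ak (φ k) - aS| < δ := by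
    have e1 : dist (ak (φ k)) aS < δ := hK₁ k hkK₁
    rwa [Real.dist_eq] at e1
  have hRk : R₀ ≤ (φ k : ℝ) + 2 := by
    have e1 : (k : ℝ) ≤ φ k := by exact_mod_cast hφk
    have e2 : (K₂ : ℝ) ≤ k := by exact_mod_cast hkK₂
    linarith
  have hηk : 1 / ((φ k : ℝ) + 1) ≤ η₀ := by
    have e1 : (k : ℝ) ≤ φ k := by exact_mod_cast hφk
    have e2 : (K₃ : ℝ) ≤ k := by exact_mod_cast hkK₃
    have e3 : 1 / η₀ ≤ (φ k : ℝ) + 1 := by linarith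
    rw [div_le_iff₀ hη₀] at e3
    rw [div_le_iff₀ (by positivity)]
    linarith
  exact ⟨Nk (φ k), le_trans hkM (le_trans hφk (hNk (φ k))), ik (φ k),
    hTr aS (ak (φ k)) _ _ haS.1 (hak1 (φ k)) hab hRk hηk _ _ (hgood (φ k))⟩

/-! ## 4. The crux -/

/-- **`FloorGivesLayered` holds.** Under FLOOR and BUDGET, every Lennard-Jones ground-state sequence has
ONE spacing `a ∈ [47/50, 1]` such that at every scale `(R, ε)`, frequently in `N`, a translate of `x N`
is two-way `ε`-matched on the ball of radius `R` with a member of the relaxed layered family of spacing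
`a` (composition of `eventually_exists_not_bad`, `spacing_selection` with the transfer supplied by
`match_dilate` + `layered_pt_scale`, read at radius `max R 1`, translated by `t := −x N i`). -/
theorem floorGivesLayered : FloorGivesLayered := by
  intro P₀ hE hD x hx
  -- Step 1: at every scale, frequently in `N`, some site of `x N` is layered-good
  have hgood : ∀ R η : ℝ, 0 < R → 0 < η → ∃ᶠ N in atTop, ∃ i : Fin N, ∃ a : ℝ, 47 / 50 ≤ a ∧ a ≤ 1 ∧
      ∃ (A : EuclideanSpace ℝ (Fin 3) →ₗᵢ[ℝ] EuclideanSpace ℝ (Fin 3)) (s : ℤ → ℤ) (z : ℤ → ℝ),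
        Literature.MathematicalPhysics.StatisticalMechanics.IsHaggSeq s ∧
        (∀ m : ℤ, 39 / 50 * a ≤ z (m + 1) - z m ∧ z (m + 1) - z m ≤ 17 / 20 * a) ∧
        let S : Set (EuclideanSpace ℝ (Fin 3)) := {p | ∃ m k l : ℤ, p = A (((k : ℝ) • Literature.MathematicalPhysics.StatisticalMechanics.triangularVec₁ a) + ((l : ℝ) • Literature.MathematicalPhysics.StatisticalMechanics.triangularVec₂ a) + ((Literature.MathematicalPhysics.StatisticalMechanics.haggLabel s m : ℝ) • Literature.MathematicalPhysics.StatisticalMechanics.barlowOffset a) + (z m • Literature.MathematicalPhysics.StatisticalMechanics.layerNormal 1))};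
        (∀ p ∈ S, ‖p‖ ≤ R → ∃ j : Fin N, dist (x N j - x N i) p ≤ η) ∧
        (∀ j : Fin N, ‖x N j - x N i‖ ≤ R → ∃ p ∈ S, dist (x N j - x N i) p ≤ η) := by
    intro R η hR hη
    obtain ⟨c, hc, hcN⟩ := hD R η hR hη
    have hev := eventually_exists_not_bad P₀ hE hc hcN
    refine (hev.mono fun N hN => ?_).frequently
    obtain ⟨i, hi⟩ := hN (x N) (hx N)
    exact ⟨i, not_not.1 hi⟩
  -- Step 2: one spacing for all scales, the transfer being dilation of the whole layered datum
  obtain ⟨a, ha1, ha2, hwin⟩ := spacing_selection hgood fun R ε hR hε => by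
    obtain ⟨η₁, hη₁0, hη₁ε, hη₁1⟩ : ∃ η₁ : ℝ, 0 < η₁ ∧ η₁ ≤ ε ∧ η₁ ≤ 1 :=
      ⟨min ε 1, lt_min hε one_pos, min_le_left _ _, min_le_right _ _⟩
    have hR1 : 0 < R + 1 := by linarith
    obtain ⟨θ, hθ0, hθR⟩ : ∃ θ : ℝ, 0 < θ ∧ θ * (R + 1) = η₁ / 2 :=
      ⟨η₁ / 2 / (R + 1), by positivity, by field_simp⟩
    refine ⟨47 / 50 * θ, by positivity, R + 1, η₁ / 2, by positivity, ?_⟩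
    intro a b R' η' ha hb hab hRR' hη' N i hG
    obtain ⟨A, s, z, hs, hbox, hM₁, hM₂⟩ := hG
    have ha0 : 0 < a := by linarith
    have hb0 : 0 < b := by linarith
    -- the dilation factor
    obtain ⟨ρ, hρ0, hρb⟩ : ∃ ρ : ℝ, 0 < ρ ∧ ρ * b = a :=
      ⟨a / b, div_pos ha0 hb0, div_mul_cancel₀ a hb0.ne'⟩
    have habs : |b - a| < 47 / 50 * θ := hab
    have h1ρ : |1 - ρ| ≤ θ := by
      have e1 : 1 - ρ = (b - a) / b := by rw [← hρb]; field_simp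
      rw [e1, abs_div, abs_of_pos hb0, div_le_iff₀ hb0]
      nlinarith [abs_nonneg (b - a)]
    have h1ρ' : |ρ⁻¹ - 1| ≤ θ := by
      have e1 : ρ⁻¹ - 1 = (b - a) / a := by rw [← hρb]; field_simp
      rw [e1, abs_div, abs_of_pos ha0, div_le_iff₀ ha0]
      nlinarith [abs_nonneg (b - a)]
    refine ⟨A, s, fun m => ρ * z m, hs, fun m => ?_, ?_⟩
    · -- the spacing box scales with `ρ`
      obtain ⟨hl, hu⟩ := hbox m
      have hl' := mul_le_mul_of_nonneg_left hl hρ0.le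
      have hu' := mul_le_mul_of_nonneg_left hu hρ0.le
      constructor
      · calc 39 / 50 * a = ρ * (39 / 50 * b) := by rw [← hρb]; ring
          _ ≤ ρ * (z (m + 1) - z m) := hl'
          _ = ρ * z (m + 1) - ρ * z m := by ring
      · calc ρ * z (m + 1) - ρ * z m = ρ * (z (m + 1) - z m) := by ring
          _ ≤ ρ * (17 / 20 * b) := hu'
          _ = 17 / 20 * a := by rw [← hρb]; ring
    · -- the two-way match at `(R, ε)` for the dilated set
      have hscale : ∀ m k l : ℤ, A (((k : ℝ) • triangularVec₁ a) + ((l : ℝ) • triangularVec₂ a) +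
          ((haggLabel s m : ℝ) • barlowOffset a) + ((ρ * z m) • layerNormal 1)) =
          ρ • A (((k : ℝ) • triangularVec₁ b) + ((l : ℝ) • triangularVec₂ b) +
          ((haggLabel s m : ℝ) • barlowOffset b) + (z m • layerNormal 1)) := by
        intro m k l
        rw [← hρb]
        exact layered_pt_scale A ρ b s z m k l
      dsimp only
      refine match_dilate (fun j => x N j - x N i) _ _ hθ0 hθR hη₁ε hη₁1 hρ0 h1ρ h1ρ' hRR' hη'
        ?_ ?_ hM₁ hM₂
      · rintro p ⟨m, k, l, rfl⟩
        exact ⟨m, k, l, (hscale m k l).symm⟩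
      · rintro p' ⟨m, k, l, rfl⟩
        exact ⟨_, ⟨m, k, l, rfl⟩, hscale m k l⟩
  -- Step 3: read the fixed-spacing good site at radius `max R 1` and translate by `t := -x N i`
  refine ⟨a, ha1, ha2, fun R ε hε => ?_⟩
  have hR' : 0 < max R 1 := lt_max_of_lt_right one_pos
  refine (hwin (max R 1) ε hR' hε).mono fun N hN => ?_
  obtain ⟨i, hi⟩ := hN
  obtain ⟨A, s, z, hs, hbox, hM₁, hM₂⟩ := hi
  refine ⟨A, -x N i, s, z, hs, hbox, ?_⟩
  have hsub : ∀ j : Fin N, x N j + -x N i = x N j - x N i := fun j =>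
    (sub_eq_add_neg (x N j) (x N i)).symm
  intro S
  refine ⟨fun p hp hpR => ?_, fun j hj => ?_⟩
  · obtain ⟨j, hj⟩ := hM₁ p hp (hpR.trans (le_max_left R 1))
    exact ⟨j, by rw [hsub j]; exact hj⟩
  · rw [hsub j] at hj ⊢
    exact hM₂ j (hj.trans (le_max_left R 1))

/-- The crux by its fully qualified route name (the deciding shape the gate probes). -/
theorem FloorGivesLayered_proof :
    Summit.AtomisticToContinuum.Crystallization.Theses.FluxTubeKepler.FloorGivesLayered :=
  floorGivesLayered

end Summit.AtomisticToContinuum.Crystallization.Theorems.FluxTubeKeplerFloorGivesLayered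

end
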